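import Summits.QuantumFields.YangMills.Theorems.ColdStartUniversalityLatticeLangevinWilsonInvariantBetaZero
import Summits.QuantumFields.YangMills.Theorems.ColdStartUniversalityLatticeLangevinLatitudeEigen
import Summits.QuantumFields.YangMills.Theorems.ColdStartUniversalityLatticeLangevinLawUniqueStart
import Summits.QuantumFields.YangMills.Theorems.ColdStartUniversalityLatticeLangevinRegularFlow
import Summits.QuantumFields.YangMills.Theorems.ColdStartUniversalityLatticeLangevinHeatKernelSU2
import Summits.QuantumFields.YangMills.Theorems.ColdStartUniversalityLatticeLangevinKernelActionContinuity
import Literature.MathematicalPhysics.QuantumFieldTheory.Balaban1983to89.MassGapTransferHC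
import HarnessLib

/-!
# Route `ColdStartUniversality` (fixed-cut-off package): moments of the MEAN LINK TRACE along the `β' = 0` cold-start flow and under Haar
# (the second-moment input of the `log L − O(1)` mixing-time LOWER bound `…LatticeLangevinMixingLowerBound`)

Helper file (seat `ym-line-csu-p1`, g28; `--supports stmt-QuantumFields-24809`).  g27: every bounded observable of the SU(2) SZZ dynamics on
`(ℤ/L)³` is within `ε` of its `μ_(β')`-mean after `2 + log(√(2B_L)/ε)/(1−12|β'|) = O(log L)` lattice time units (`|β'| < 1/12`); g28: macroscopic
(smooth, spatially averaged) observables need only `O(log(1/ε))`.  Here the first statement is shown to be SHARP already at `β' = 0` (product Brownian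
motion on `SU(2)^E`, invariant measure `μ_0 = Haar^(⊗E)`): with the mean link trace `G = (#E)⁻¹ Σ_e Re tr U_e` (`= (#E)⁻¹Σ_e U_1(⟨1, U_e⟩/2)`, a
latitude eigenfunction per link),
* `integral_prod_linkTrace_coldStart_beta_zero` — `E ∏_(e∈S) Re tr U_e(t) = 2^#S · e^(−(3/2)#S·t)` for the regular cold-start flow (every finite `S`);
* `integral_prod_linkTrace_pi_haar` — `∫ ∏_(e∈S) Re tr y_e dHaar^(⊗E) = [S = ∅]`;
* ★★ `wilson_coldStart_meanLinkTrace_moments_beta_zero` — `E G(U_t) = 2e^(−3t/2)`, `E (G(U_t) − 2e^(−3t/2))² ≤ 4/#E`, `∫ G² dμ_0 ≤ 4/#E`;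
(the lower bound itself — `E g(U_t) − ∫ g dμ_0 ≥ 1/2` for the indicator `g` of `{G ≥ e^(−3t/2)}` while `16e^(3t) ≤ #E`, i.e. a `½`-mixing time
`≥ (1/3)log(3L³/16) = log L − O(1)` — is the sequel `…LatticeLangevinMixingLowerBound`).  Ingredients: `integral_prod_gegenbauer_latitude` (closed-form
latitude moments of the `β' = 0` flow), `integral_prod_gegenbauer_latitude_pi_haar`.  THEOREMS ONLY, no definition, no sorry.
HONEST FRAMING: fixed cut-off, `β' = 0` only; nothing K-uniform; 24809 ASIDE not restated; no crux, rung or summit statement is proved; the Yang–Mills mass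
gap is NOT proved. [folklore]
-/

set_option autoImplicit false

noncomputable section

namespace Summit.QuantumFields.YangMills.Theorems.ColdStartUniversality

open MeasureTheory ProbabilityTheory Finset
open scoped BigOperators NNReal ENNReal
open Literature.Probability.Process Literature.MathematicalPhysics.QuantumFieldTheory
open Literature.MathematicalPhysics.QuantumLattice (fundamentalRep fundamentalLatticeRep continuous_fundamentalRep)
open Literature.Analysis.SpecialFunctions (gegenbauerSum gegenbauerSum_one gegenbauerSum_zero)

variable {L : ℕ} [NeZero L]

/-! ## §1. The link trace as the first latitude eigenfunction; bounds -/

/-- `U_1(⟨ρ1, ρV⟩/2) = Re tr V` for `V ∈ SU(2)` (`U_1(s) = 2s`, `⟨1, M⟩_HS = Re tr M`). [folklore] -/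
theorem gegenbauerSum_one_latitude_one_eq (V : Matrix.specialUnitaryGroup (Fin 2) ℂ) :
    gegenbauerSum 1 1 (hsForm 2 (fundamentalRep (Fin 2) 1) (fundamentalRep (Fin 2) V) / 2) = ((V : Matrix (Fin 2) (Fin 2) ℂ).trace).re := by
  rw [gegenbauerSum_one, map_one, hsForm_apply, Matrix.one_mul, Matrix.trace_conjTranspose, Complex.star_def, Complex.conj_re,
    Literature.MathematicalPhysics.QuantumLattice.fundamentalRep_apply]
  ring

/-- `|U_1(⟨ρ1, ρV⟩/2)| ≤ 2` on `SU(2)`. [folklore] -/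
theorem abs_gegenbauerSum_one_latitude_one_le (V : Matrix.specialUnitaryGroup (Fin 2) ℂ) :
    |gegenbauerSum 1 1 (hsForm 2 (fundamentalRep (Fin 2) 1) (fundamentalRep (Fin 2) V) / 2)| ≤ 2 := by
  rw [gegenbauerSum_one_latitude_one_eq]
  have h := abs_re_trace_div_two_le V
  rw [abs_div, abs_two] at h
  linarith [h, div_le_iff₀ (two_pos : (0:ℝ) < 2) |>.1 h]

/-- At the identity, `⟨ρ1, ρ1⟩/2 = 1`. [folklore] -/
theorem hsForm_one_one_div_two : hsForm 2 (fundamentalRep (Fin 2) 1) (fundamentalRep (Fin 2) 1) / 2 = 1 := by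
  rw [map_one, hsForm_apply, Matrix.conjTranspose_one, Matrix.mul_one, Matrix.trace_one, Fintype.card_fin]
  norm_num

/-- Product bookkeeping: for a {0,1}-valued multiplicity pattern, `∏_e U_(𝟙_S(e))(s_e) = ∏_(e∈S) U_1(s_e)` (`U_0 = 1`). [folklore] -/
theorem prod_gegenbauerSum_indicator (S : Finset (Edge 3 L)) (s : Edge 3 L → ℝ) :
    ∏ e, gegenbauerSum 1 (if e ∈ S then 1 else 0) (s e) = ∏ e ∈ S, gegenbauerSum 1 1 (s e) := by
  classical
  have h : ∀ e, gegenbauerSum 1 (if e ∈ S then 1 else 0) (s e) = if e ∈ S then gegenbauerSum 1 1 (s e) else 1 := by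
    intro e; by_cases he : e ∈ S
    · rw [if_pos he, if_pos he]
    · rw [if_neg he, if_neg he, gegenbauerSum_zero]
  simp_rw [h]
  rw [Finset.prod_ite_mem, Finset.univ_inter]

/-- Exponent bookkeeping: `Σ_e m_e(m_e+2)/2 = (3/2)·#S` for the indicator pattern of `S`. [folklore] -/
theorem sum_indicator_eigenvalue (S : Finset (Edge 3 L)) :
    ∑ e, ((if e ∈ S then 1 else 0 : ℕ) : ℝ) * (((if e ∈ S then 1 else 0 : ℕ) : ℝ) + 2) / 2 = 3 / 2 * (S.card : ℝ) := by
  classical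
  have h : ∀ e : Edge 3 L, ((if e ∈ S then 1 else 0 : ℕ) : ℝ) * (((if e ∈ S then 1 else 0 : ℕ) : ℝ) + 2) / 2 = if e ∈ S then (3 / 2 : ℝ) else 0 := by
    intro e; by_cases he : e ∈ S
    · rw [if_pos he, if_pos he]; norm_num
    · rw [if_neg he, if_neg he]; norm_num
  simp_rw [h]
  rw [Finset.sum_ite_mem, Finset.univ_inter, Finset.sum_const, nsmul_eq_mul, mul_comm]

/-! ## §2. Closed-form moments of products of link traces -/

/-- **Moments of products of link traces along the regular `β' = 0` cold-start flow**: for the regular solution family `U` of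
`exists_regularFlow` (from every start, jointly measurable) and every finite set `S` of links,
`E ∏_(e∈S) Re tr U^1_e(t) = e^(−(3/2)·#S·t) · 2^#S`. [folklore] -/
theorem integral_prod_linkTrace_coldStart_beta_zero {Ω : Type} [MeasurableSpace Ω] {P : Measure Ω}
    [IsProbabilityMeasure P] {W : ℝ≥0 → Ω → (Edge 3 L × NoiseIdx 2 → ℝ)} (hW : IsFlatBrownian W P)
    (U : GaugeConfig 3 L (Matrix.specialUnitaryGroup (Fin 2) ℂ) → ℝ≥0 → Ω →
      GaugeConfig 3 L (Matrix.specialUnitaryGroup (Fin 2) ℂ))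
    (hU : ∀ x, (∀ ω, U x 0 ω = x) ∧
      (latticeLangevinDynamics (fundamentalLatticeRep 2) 0).IsSolution (fundamentalRep (Fin 2))
        hW.natFiltration P W (U x))
    (hUm : ∀ i : ℝ≥0, Measurable[@Prod.instMeasurableSpace (Set.Iic i)
        (GaugeConfig 3 L (Matrix.specialUnitaryGroup (Fin 2) ℂ) × Ω) inferInstance
        (@Prod.instMeasurableSpace (GaugeConfig 3 L (Matrix.specialUnitaryGroup (Fin 2) ℂ)) Ω inferInstance
          (hW.natFiltration i))]
      (fun q : Set.Iic i × (GaugeConfig 3 L (Matrix.specialUnitaryGroup (Fin 2) ℂ) × Ω) => U q.2.1 q.1 q.2.2))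
    (S : Finset (Edge 3 L)) (t : ℝ≥0) :
    ∫ ω, ∏ e ∈ S, gegenbauerSum 1 1 (hsForm 2 (fundamentalRep (Fin 2) 1) (fundamentalRep (Fin 2) (U (fun _ => 1) t ω e)) / 2) ∂P
      = Real.exp (-(3 / 2 * (S.card : ℝ)) * t) * 2 ^ S.card := by
  classical
  have h := integral_prod_gegenbauer_latitude hW U hU hUm (fun _ => 1) (fun _ => 1) (fun e => if e ∈ S then 1 else 0) t
  have hL : ∀ ω, (∏ e, gegenbauerSum 1 ((fun e => if e ∈ S then 1 else 0) e)
      (hsForm 2 (fundamentalRep (Fin 2) ((fun _ : Edge 3 L => (1 : Matrix.specialUnitaryGroup (Fin 2) ℂ)) e)) (fundamentalRep (Fin 2) (U (fun _ => 1) t ω e)) / 2))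
      = ∏ e ∈ S, gegenbauerSum 1 1 (hsForm 2 (fundamentalRep (Fin 2) 1) (fundamentalRep (Fin 2) (U (fun _ => 1) t ω e)) / 2) :=
    fun ω => prod_gegenbauerSum_indicator S _
  have hR : (∏ e, gegenbauerSum 1 ((fun e => if e ∈ S then 1 else 0) e)
      (hsForm 2 (fundamentalRep (Fin 2) ((fun _ : Edge 3 L => (1 : Matrix.specialUnitaryGroup (Fin 2) ℂ)) e)) (fundamentalRep (Fin 2) ((fun _ : Edge 3 L => (1 : Matrix.specialUnitaryGroup (Fin 2) ℂ)) e)) / 2))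
      = 2 ^ S.card := by
    have h1 : (∏ e, gegenbauerSum 1 ((fun e => if e ∈ S then 1 else 0) e)
        (hsForm 2 (fundamentalRep (Fin 2) ((fun _ : Edge 3 L => (1 : Matrix.specialUnitaryGroup (Fin 2) ℂ)) e)) (fundamentalRep (Fin 2) ((fun _ : Edge 3 L => (1 : Matrix.specialUnitaryGroup (Fin 2) ℂ)) e)) / 2))
        = ∏ e ∈ S, gegenbauerSum 1 1 (hsForm 2 (fundamentalRep (Fin 2) 1) (fundamentalRep (Fin 2) 1) / 2) := prod_gegenbauerSum_indicator S _
    rw [h1, hsForm_one_one_div_two, gegenbauerSum_one, Finset.prod_const]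
    norm_num
  have hE : (∑ e, (((fun e => if e ∈ S then 1 else 0) e : ℕ) : ℝ) * ((((fun e => if e ∈ S then 1 else 0) e : ℕ) : ℝ) + 2) / 2) = 3 / 2 * (S.card : ℝ) :=
    sum_indicator_eigenvalue S
  rw [integral_congr_ae (ae_of_all _ hL)] at h
  rw [h, hR, hE]

/-- **Haar integrals of products of link traces**: `∫ ∏_(e∈S) Re tr y_e dHaar^(⊗E)(y) = [S = ∅]`. [folklore] -/
theorem integral_prod_linkTrace_pi_haar (S : Finset (Edge 3 L)) :
    ∫ y, ∏ e ∈ S, gegenbauerSum 1 1 (hsForm 2 (fundamentalRep (Fin 2) 1) (fundamentalRep (Fin 2) (y e)) / 2)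
      ∂(Measure.pi fun _ : Edge 3 L => haarProbability (Matrix.specialUnitaryGroup (Fin 2) ℂ)) = if S = ∅ then 1 else 0 := by
  classical
  have h := integral_prod_gegenbauer_latitude_pi_haar (L := L) (fun _ => 1) (fun e => if e ∈ S then 1 else 0)
  have hL : ∀ y : GaugeConfig 3 L (Matrix.specialUnitaryGroup (Fin 2) ℂ), (∏ e, gegenbauerSum 1 ((fun e => if e ∈ S then 1 else 0) e)
      (hsForm 2 (fundamentalRep (Fin 2) ((fun _ : Edge 3 L => (1 : Matrix.specialUnitaryGroup (Fin 2) ℂ)) e)) (fundamentalRep (Fin 2) (y e)) / 2))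
      = ∏ e ∈ S, gegenbauerSum 1 1 (hsForm 2 (fundamentalRep (Fin 2) 1) (fundamentalRep (Fin 2) (y e)) / 2) :=
    fun y => prod_gegenbauerSum_indicator S _
  rw [integral_congr_ae (ae_of_all _ hL)] at h
  rw [h]
  have hiff : ((fun e : Edge 3 L => if e ∈ S then (1 : ℕ) else 0) = 0) ↔ S = ∅ := by
    constructor
    · intro hm
      ext e
      simp only [Finset.notMem_empty, iff_false]
      intro he
      have := congrFun hm e
      simp [he] at this
    · intro hS; subst hS; funext e; simp
  by_cases hS : S = ∅
  · rw [if_pos hS, if_pos (hiff.2 hS)]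
  · rw [if_neg hS, if_neg (mt hiff.1 hS)]


/-! ## §3. The mean link trace `G = (#E)⁻¹ Σ_e Re tr U_e`: first and second moments -/

/-- `V ↦ U_1(⟨ρ1, ρV_e⟩/2) = Re tr V_e` is continuous. [folklore] -/
theorem continuous_linkTrace (e : Edge 3 L) :
    Continuous fun V : GaugeConfig 3 L (Matrix.specialUnitaryGroup (Fin 2) ℂ) => gegenbauerSum 1 1 (hsForm 2 (fundamentalRep (Fin 2) 1) (fundamentalRep (Fin 2) (V e)) / 2) := by
  classical
  have h := continuous_prod_gegenbauer_latitude (L := L) (fun _ => 1) (fun e' => if e' ∈ ({e} : Finset (Edge 3 L)) then 1 else 0)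
  refine (h.congr fun V => ?_)
  rw [prod_gegenbauerSum_indicator, Finset.prod_singleton]

/-- `|U_1(⟨ρ1, ρV_e⟩/2)|`-average: `|(#E)⁻¹ Σ_e Re tr V_e| ≤ 2`. [folklore] -/
theorem abs_meanLinkTrace_le_two (V : GaugeConfig 3 L (Matrix.specialUnitaryGroup (Fin 2) ℂ)) : |(((Fintype.card (Edge 3 L) : ℝ))⁻¹ * ∑ e, gegenbauerSum 1 1 (hsForm 2 (fundamentalRep (Fin 2) 1) (fundamentalRep (Fin 2) (V e)) / 2))| ≤ 2 := by
  have hnEpos : 0 < (Fintype.card (Edge 3 L) : ℝ) := by exact_mod_cast Fintype.card_pos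
  rw [abs_mul, abs_inv, abs_of_pos hnEpos]
  calc ((Fintype.card (Edge 3 L) : ℝ))⁻¹ * |∑ e, gegenbauerSum 1 1 (hsForm 2 (fundamentalRep (Fin 2) 1) (fundamentalRep (Fin 2) (V e)) / 2)| ≤ ((Fintype.card (Edge 3 L) : ℝ))⁻¹ * ∑ e, |gegenbauerSum 1 1 (hsForm 2 (fundamentalRep (Fin 2) 1) (fundamentalRep (Fin 2) (V e)) / 2)| :=
        mul_le_mul_of_nonneg_left (Finset.abs_sum_le_sum_abs _ _) (inv_nonneg.2 hnEpos.le)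
    _ ≤ ((Fintype.card (Edge 3 L) : ℝ))⁻¹ * ∑ _e : Edge 3 L, (2 : ℝ) :=
        mul_le_mul_of_nonneg_left (Finset.sum_le_sum fun e _ => abs_gegenbauerSum_one_latitude_one_le (V e)) (inv_nonneg.2 hnEpos.le)
    _ = 2 := by rw [Finset.sum_const, Finset.card_univ, nsmul_eq_mul, ← mul_assoc, inv_mul_cancel₀ hnEpos.ne', one_mul]

/-- ★★ **Moments of the mean link trace along the `β' = 0` cold-start flow** (regular solution family `U` of `exists_regularFlow`, start `1`):
with `G = (#E)⁻¹Σ_e Re tr U_e` and `m_t = 2e^(−3t/2)`: `E G(U_t) = m_t` and `E (G(U_t) − m_t)² ≤ 4/#E`. [folklore] -/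
theorem wilson_coldStart_meanLinkTrace_moments_beta_zero {Ω : Type} [MeasurableSpace Ω] {P : Measure Ω}
    [IsProbabilityMeasure P] {W : ℝ≥0 → Ω → (Edge 3 L × NoiseIdx 2 → ℝ)} (hW : IsFlatBrownian W P)
    (U : GaugeConfig 3 L (Matrix.specialUnitaryGroup (Fin 2) ℂ) → ℝ≥0 → Ω →
      GaugeConfig 3 L (Matrix.specialUnitaryGroup (Fin 2) ℂ))
    (hU : ∀ x, (∀ ω, U x 0 ω = x) ∧
      (latticeLangevinDynamics (fundamentalLatticeRep 2) 0).IsSolution (fundamentalRep (Fin 2))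
        hW.natFiltration P W (U x))
    (hUm : ∀ i : ℝ≥0, Measurable[@Prod.instMeasurableSpace (Set.Iic i)
        (GaugeConfig 3 L (Matrix.specialUnitaryGroup (Fin 2) ℂ) × Ω) inferInstance
        (@Prod.instMeasurableSpace (GaugeConfig 3 L (Matrix.specialUnitaryGroup (Fin 2) ℂ)) Ω inferInstance
          (hW.natFiltration i))]
      (fun q : Set.Iic i × (GaugeConfig 3 L (Matrix.specialUnitaryGroup (Fin 2) ℂ) × Ω) => U q.2.1 q.1 q.2.2))
    (t : ℝ≥0) :
    (∫ ω, (((Fintype.card (Edge 3 L) : ℝ))⁻¹ * ∑ e, gegenbauerSum 1 1 (hsForm 2 (fundamentalRep (Fin 2) 1) (fundamentalRep (Fin 2) (U (fun _ => 1) t ω e)) / 2)) ∂P = 2 * Real.exp (-(3 / 2) * t)) ∧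
    (∫ ω, ((((Fintype.card (Edge 3 L) : ℝ))⁻¹ * ∑ e, gegenbauerSum 1 1 (hsForm 2 (fundamentalRep (Fin 2) 1) (fundamentalRep (Fin 2) (U (fun _ => 1) t ω e)) / 2)) - 2 * Real.exp (-(3 / 2) * t)) ^ 2 ∂P ≤ 4 / (Fintype.card (Edge 3 L) : ℝ)) := by
  classical
  have hnEpos : 0 < (Fintype.card (Edge 3 L) : ℝ) := by exact_mod_cast Fintype.card_pos
  set V' : ℝ≥0 → Ω → GaugeConfig 3 L (Matrix.specialUnitaryGroup (Fin 2) ℂ) := U (fun _ => 1) with hV'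
  have hmV : Measurable (V' t) := ((hU (fun _ => 1)).2.adapted t).mono (hW.natFiltration.le t) le_rfl
  set m : ℝ := 2 * Real.exp (-(3 / 2) * t) with hm
  -- single link traces: bounded, measurable, integrable
  have hXb : ∀ (e : Edge 3 L) (V : GaugeConfig 3 L (Matrix.specialUnitaryGroup (Fin 2) ℂ)), |gegenbauerSum 1 1 (hsForm 2 (fundamentalRep (Fin 2) 1) (fundamentalRep (Fin 2) (V e)) / 2)| ≤ 2 :=
    fun e V => abs_gegenbauerSum_one_latitude_one_le (V e)
  have hXm : ∀ e : Edge 3 L, Measurable fun ω => gegenbauerSum 1 1 (hsForm 2 (fundamentalRep (Fin 2) 1) (fundamentalRep (Fin 2) (V' t ω e)) / 2) :=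
    fun e => (continuous_linkTrace e).measurable.comp hmV
  have hXi : ∀ e : Edge 3 L, Integrable (fun ω => gegenbauerSum 1 1 (hsForm 2 (fundamentalRep (Fin 2) 1) (fundamentalRep (Fin 2) (V' t ω e)) / 2)) P := fun e =>
    Integrable.of_bound (hXm e).aestronglyMeasurable 2 (ae_of_all _ fun ω => by rw [Real.norm_eq_abs]; exact hXb e _)
  have hXXi : ∀ e e' : Edge 3 L, Integrable (fun ω => gegenbauerSum 1 1 (hsForm 2 (fundamentalRep (Fin 2) 1) (fundamentalRep (Fin 2) (V' t ω e)) / 2) * gegenbauerSum 1 1 (hsForm 2 (fundamentalRep (Fin 2) 1) (fundamentalRep (Fin 2) (V' t ω e')) / 2)) P := by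
    intro e e'
    exact (hXi e).mul_bdd (hXm e').aestronglyMeasurable (ae_of_all _ fun ω => by rw [Real.norm_eq_abs]; exact hXb e' _)
  -- first moments: `E X_e = 2 e^(−3t/2)`
  have hX1 : ∀ e : Edge 3 L, ∫ ω, gegenbauerSum 1 1 (hsForm 2 (fundamentalRep (Fin 2) 1) (fundamentalRep (Fin 2) (V' t ω e)) / 2) ∂P = m := by
    intro e
    have h := integral_prod_linkTrace_coldStart_beta_zero hW U hU hUm ({e} : Finset (Edge 3 L)) t
    simp only [Finset.prod_singleton, Finset.card_singleton] at h
    rw [hV', h, hm]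
    norm_num
    ring_nf
  -- mixed moments: `E X_e X_e' = 4 e^(−3t)` for `e ≠ e'`
  have hX2 : ∀ e e' : Edge 3 L, e ≠ e' → ∫ ω, gegenbauerSum 1 1 (hsForm 2 (fundamentalRep (Fin 2) 1) (fundamentalRep (Fin 2) (V' t ω e)) / 2) * gegenbauerSum 1 1 (hsForm 2 (fundamentalRep (Fin 2) 1) (fundamentalRep (Fin 2) (V' t ω e')) / 2) ∂P = 4 * Real.exp (-3 * t) := by
    intro e e' hne
    have h := integral_prod_linkTrace_coldStart_beta_zero hW U hU hUm ({e, e'} : Finset (Edge 3 L)) t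
    simp only [Finset.prod_pair hne, Finset.card_pair hne] at h
    rw [hV', h]
    norm_num
    ring_nf
  -- E G = m
  have hEG : ∫ ω, (((Fintype.card (Edge 3 L) : ℝ))⁻¹ * ∑ e, gegenbauerSum 1 1 (hsForm 2 (fundamentalRep (Fin 2) 1) (fundamentalRep (Fin 2) (V' t ω e)) / 2)) ∂P = m := by
    rw [integral_const_mul, integral_finsetSum _ fun e _ => hXi e]
    simp_rw [hX1]
    rw [Finset.sum_const, Finset.card_univ, nsmul_eq_mul, ← mul_assoc, inv_mul_cancel₀ hnEpos.ne', one_mul]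
  -- pair bound
  have hpair : ∀ e e' : Edge 3 L, ∫ ω, gegenbauerSum 1 1 (hsForm 2 (fundamentalRep (Fin 2) 1) (fundamentalRep (Fin 2) (V' t ω e)) / 2) * gegenbauerSum 1 1 (hsForm 2 (fundamentalRep (Fin 2) 1) (fundamentalRep (Fin 2) (V' t ω e')) / 2) ∂P ≤ 4 * (if e = e' then 1 else 0) + 4 * Real.exp (-3 * t) := by
    intro e e'
    by_cases hee : e = e'
    · subst hee
      rw [if_pos rfl, mul_one]
      have h4 : ∫ ω, gegenbauerSum 1 1 (hsForm 2 (fundamentalRep (Fin 2) 1) (fundamentalRep (Fin 2) (V' t ω e)) / 2) * gegenbauerSum 1 1 (hsForm 2 (fundamentalRep (Fin 2) 1) (fundamentalRep (Fin 2) (V' t ω e)) / 2) ∂P ≤ ∫ _ω, (4 : ℝ) ∂P := by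
        refine integral_mono (hXXi e e) (integrable_const _) fun ω => ?_
        have hb := hXb e (V' t ω)
        have hsq : gegenbauerSum 1 1 (hsForm 2 (fundamentalRep (Fin 2) 1) (fundamentalRep (Fin 2) (V' t ω e)) / 2) * gegenbauerSum 1 1 (hsForm 2 (fundamentalRep (Fin 2) 1) (fundamentalRep (Fin 2) (V' t ω e)) / 2) = |gegenbauerSum 1 1 (hsForm 2 (fundamentalRep (Fin 2) 1) (fundamentalRep (Fin 2) (V' t ω e)) / 2)| ^ 2 := by rw [sq_abs, sq]
        rw [hsq]
        nlinarith [abs_nonneg (gegenbauerSum 1 1 (hsForm 2 (fundamentalRep (Fin 2) 1) (fundamentalRep (Fin 2) (V' t ω e)) / 2))]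
      rw [integral_const, smul_eq_mul, probReal_univ, one_mul] at h4
      linarith [Real.exp_pos (-3 * (t : ℝ))]
    · rw [if_neg hee, hX2 e e' hee]
      linarith
  have hEG2 : ∫ ω, ((((Fintype.card (Edge 3 L) : ℝ))⁻¹ * ∑ e, gegenbauerSum 1 1 (hsForm 2 (fundamentalRep (Fin 2) 1) (fundamentalRep (Fin 2) (V' t ω e)) / 2))) ^ 2 ∂P ≤ 4 / (Fintype.card (Edge 3 L) : ℝ) + 4 * Real.exp (-3 * t) := by
    have hexp : ∀ ω, ((((Fintype.card (Edge 3 L) : ℝ))⁻¹ * ∑ e, gegenbauerSum 1 1 (hsForm 2 (fundamentalRep (Fin 2) 1) (fundamentalRep (Fin 2) (V' t ω e)) / 2))) ^ 2 = (Fintype.card (Edge 3 L) : ℝ)⁻¹ ^ 2 * ∑ e, ∑ e', gegenbauerSum 1 1 (hsForm 2 (fundamentalRep (Fin 2) 1) (fundamentalRep (Fin 2) (V' t ω e)) / 2) * gegenbauerSum 1 1 (hsForm 2 (fundamentalRep (Fin 2) 1) (fundamentalRep (Fin 2) (V' t ω e')) / 2) := by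
      intro ω
      rw [mul_pow, sq (∑ e, _), Finset.sum_mul_sum]
    simp_rw [hexp]
    rw [integral_const_mul, integral_finsetSum _ fun e _ => integrable_finsetSum _ fun e' _ => hXXi e e']
    simp_rw [integral_finsetSum _ fun e' _ => hXXi _ e']
    have hsum : ∑ e : Edge 3 L, ∑ e' : Edge 3 L, ∫ ω, gegenbauerSum 1 1 (hsForm 2 (fundamentalRep (Fin 2) 1) (fundamentalRep (Fin 2) (V' t ω e)) / 2) * gegenbauerSum 1 1 (hsForm 2 (fundamentalRep (Fin 2) 1) (fundamentalRep (Fin 2) (V' t ω e')) / 2) ∂P ≤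
        ∑ e : Edge 3 L, ∑ e' : Edge 3 L, (4 * (if e = e' then 1 else 0) + 4 * Real.exp (-3 * (t : ℝ))) :=
      Finset.sum_le_sum fun e _ => Finset.sum_le_sum fun e' _ => hpair e e'
    have hval : ∑ e : Edge 3 L, ∑ e' : Edge 3 L, (4 * (if e = e' then 1 else 0) + 4 * Real.exp (-3 * (t : ℝ))) = 4 * (Fintype.card (Edge 3 L) : ℝ) + 4 * Real.exp (-3 * t) * (Fintype.card (Edge 3 L) : ℝ) ^ 2 := by
      have h1 : ∀ e : Edge 3 L, ∑ e' : Edge 3 L, (4 * (if e = e' then 1 else 0) + 4 * Real.exp (-3 * (t : ℝ))) = 4 + 4 * Real.exp (-3 * (t : ℝ)) * (Fintype.card (Edge 3 L) : ℝ) := by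
        intro e
        rw [Finset.sum_add_distrib, Finset.sum_const, Finset.card_univ, nsmul_eq_mul]
        have h2 : ∑ e' : Edge 3 L, (4 * (if e = e' then 1 else 0) : ℝ) = 4 := by
          rw [Finset.sum_eq_single e]
          · simp
          · intro e' _ hne; rw [if_neg (Ne.symm hne)]; ring
          · intro h; exact absurd (Finset.mem_univ e) h
        rw [h2]; ring
      simp_rw [h1]
      rw [Finset.sum_const, Finset.card_univ, nsmul_eq_mul]; ring
    rw [hval] at hsum
    have hinv : 0 < (Fintype.card (Edge 3 L) : ℝ)⁻¹ ^ 2 := by positivity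
    calc (Fintype.card (Edge 3 L) : ℝ)⁻¹ ^ 2 * ∑ e : Edge 3 L, ∑ e' : Edge 3 L, ∫ ω, gegenbauerSum 1 1 (hsForm 2 (fundamentalRep (Fin 2) 1) (fundamentalRep (Fin 2) (V' t ω e)) / 2) * gegenbauerSum 1 1 (hsForm 2 (fundamentalRep (Fin 2) 1) (fundamentalRep (Fin 2) (V' t ω e')) / 2) ∂P
        ≤ (Fintype.card (Edge 3 L) : ℝ)⁻¹ ^ 2 * (4 * (Fintype.card (Edge 3 L) : ℝ) + 4 * Real.exp (-3 * t) * (Fintype.card (Edge 3 L) : ℝ) ^ 2) := mul_le_mul_of_nonneg_left hsum hinv.le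
      _ = 4 / (Fintype.card (Edge 3 L) : ℝ) + 4 * Real.exp (-3 * t) := by field_simp
  -- the centred second moment
  have hGi : Integrable (fun ω => (((Fintype.card (Edge 3 L) : ℝ))⁻¹ * ∑ e, gegenbauerSum 1 1 (hsForm 2 (fundamentalRep (Fin 2) 1) (fundamentalRep (Fin 2) (V' t ω e)) / 2))) P := (integrable_finsetSum _ fun e _ => hXi e).const_mul _
  have hGb : ∀ ω, |(((Fintype.card (Edge 3 L) : ℝ))⁻¹ * ∑ e, gegenbauerSum 1 1 (hsForm 2 (fundamentalRep (Fin 2) 1) (fundamentalRep (Fin 2) (V' t ω e)) / 2))| ≤ 2 := fun ω => abs_meanLinkTrace_le_two (V' t ω)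
  have hGm : Measurable fun ω => (((Fintype.card (Edge 3 L) : ℝ))⁻¹ * ∑ e, gegenbauerSum 1 1 (hsForm 2 (fundamentalRep (Fin 2) 1) (fundamentalRep (Fin 2) (V' t ω e)) / 2)) := (Finset.measurable_sum _ fun e _ => hXm e).const_mul _
  have hG2i : Integrable (fun ω => ((((Fintype.card (Edge 3 L) : ℝ))⁻¹ * ∑ e, gegenbauerSum 1 1 (hsForm 2 (fundamentalRep (Fin 2) 1) (fundamentalRep (Fin 2) (V' t ω e)) / 2))) ^ 2) P := by
    refine Integrable.of_bound (hGm.pow_const 2).aestronglyMeasurable 4 (ae_of_all _ fun ω => ?_)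
    rw [Real.norm_eq_abs, abs_pow]
    nlinarith [hGb ω, abs_nonneg ((((Fintype.card (Edge 3 L) : ℝ))⁻¹ * ∑ e, gegenbauerSum 1 1 (hsForm 2 (fundamentalRep (Fin 2) 1) (fundamentalRep (Fin 2) (V' t ω e)) / 2)))]
  have hm2 : m ^ 2 = 4 * Real.exp (-3 * t) := by
    rw [hm, mul_pow, sq (Real.exp _), ← Real.exp_add]; ring_nf
  refine ⟨hEG, ?_⟩
  have hexpand : ∀ ω, ((((Fintype.card (Edge 3 L) : ℝ))⁻¹ * ∑ e, gegenbauerSum 1 1 (hsForm 2 (fundamentalRep (Fin 2) 1) (fundamentalRep (Fin 2) (V' t ω e)) / 2)) - m) ^ 2 = ((((Fintype.card (Edge 3 L) : ℝ))⁻¹ * ∑ e, gegenbauerSum 1 1 (hsForm 2 (fundamentalRep (Fin 2) 1) (fundamentalRep (Fin 2) (V' t ω e)) / 2))) ^ 2 - 2 * m * (((Fintype.card (Edge 3 L) : ℝ))⁻¹ * ∑ e, gegenbauerSum 1 1 (hsForm 2 (fundamentalRep (Fin 2) 1) (fundamentalRep (Fin 2) (V' t ω e)) / 2)) + m ^ 2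 := fun ω => by ring
  simp_rw [hexpand]
  have hImG : Integrable (fun ω => 2 * m * (((Fintype.card (Edge 3 L) : ℝ))⁻¹ * ∑ e, gegenbauerSum 1 1 (hsForm 2 (fundamentalRep (Fin 2) 1) (fundamentalRep (Fin 2) (V' t ω e)) / 2))) P := hGi.const_mul (2 * m)
  have hI1 : Integrable (fun ω => ((((Fintype.card (Edge 3 L) : ℝ))⁻¹ * ∑ e, gegenbauerSum 1 1 (hsForm 2 (fundamentalRep (Fin 2) 1) (fundamentalRep (Fin 2) (V' t ω e)) / 2))) ^ 2 - 2 * m * (((Fintype.card (Edge 3 L) : ℝ))⁻¹ * ∑ e, gegenbauerSum 1 1 (hsForm 2 (fundamentalRep (Fin 2) 1) (fundamentalRep (Fin 2) (V' t ω e)) / 2))) P := hG2i.sub hImG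
  rw [integral_add hI1 (integrable_const _), integral_sub hG2i hImG, integral_const_mul, hEG,
    integral_const, smul_eq_mul, probReal_univ, one_mul]
  nlinarith [hEG2, hm2]

/-- **Second moment of the mean link trace under `Haar^(⊗E)`**: `∫ G² dHaar^(⊗E) ≤ 4/#E` (off-diagonal terms vanish). [folklore] -/
theorem integral_meanLinkTrace_sq_pi_haar_le :
    ∫ y, ((((Fintype.card (Edge 3 L) : ℝ))⁻¹ * ∑ e, gegenbauerSum 1 1 (hsForm 2 (fundamentalRep (Fin 2) 1) (fundamentalRep (Fin 2) (y e)) / 2))) ^ 2 ∂(Measure.pi fun _ : Edge 3 L => haarProbability (Matrix.specialUnitaryGroup (Fin 2) ℂ)) ≤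
      4 / (Fintype.card (Edge 3 L) : ℝ) := by
  classical
  haveI : IsProbabilityMeasure (haarProbability (Matrix.specialUnitaryGroup (Fin 2) ℂ)) := inferInstance
  set π : Measure (GaugeConfig 3 L (Matrix.specialUnitaryGroup (Fin 2) ℂ)) := Measure.pi fun _ : Edge 3 L => haarProbability (Matrix.specialUnitaryGroup (Fin 2) ℂ) with hπ
  haveI : IsProbabilityMeasure π := by rw [hπ]; infer_instance
  haveI := secondCountableTopology_su2
  haveI := borelSpace_config L
  have hnEpos : 0 < (Fintype.card (Edge 3 L) : ℝ) := by exact_mod_cast Fintype.card_pos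
  have hXb : ∀ (e : Edge 3 L) (V : GaugeConfig 3 L (Matrix.specialUnitaryGroup (Fin 2) ℂ)), |gegenbauerSum 1 1 (hsForm 2 (fundamentalRep (Fin 2) 1) (fundamentalRep (Fin 2) (V e)) / 2)| ≤ 2 :=
    fun e V => abs_gegenbauerSum_one_latitude_one_le (V e)
  have hXXi : ∀ e e' : Edge 3 L, Integrable (fun y : GaugeConfig 3 L (Matrix.specialUnitaryGroup (Fin 2) ℂ) => gegenbauerSum 1 1 (hsForm 2 (fundamentalRep (Fin 2) 1) (fundamentalRep (Fin 2) (y e)) / 2) * gegenbauerSum 1 1 (hsForm 2 (fundamentalRep (Fin 2) 1) (fundamentalRep (Fin 2) (y e')) / 2)) π :=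
    fun e e' => integrable_of_continuous_of_compactSpace ((continuous_linkTrace e).mul (continuous_linkTrace e')) _
  have hpair : ∀ e e' : Edge 3 L, ∫ y, gegenbauerSum 1 1 (hsForm 2 (fundamentalRep (Fin 2) 1) (fundamentalRep (Fin 2) (y e)) / 2) * gegenbauerSum 1 1 (hsForm 2 (fundamentalRep (Fin 2) 1) (fundamentalRep (Fin 2) (y e')) / 2) ∂π ≤ 4 * (if e = e' then 1 else 0) := by
    intro e e'
    by_cases hee : e = e'
    · subst hee
      rw [if_pos rfl, mul_one]
      have h4 : ∫ y, gegenbauerSum 1 1 (hsForm 2 (fundamentalRep (Fin 2) 1) (fundamentalRep (Fin 2) (y e)) / 2) * gegenbauerSum 1 1 (hsForm 2 (fundamentalRep (Fin 2) 1) (fundamentalRep (Fin 2) (y e)) / 2) ∂π ≤ ∫ _y, (4 : ℝ) ∂π := by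
        refine integral_mono (hXXi e e) (integrable_const _) fun y => ?_
        have hsq : gegenbauerSum 1 1 (hsForm 2 (fundamentalRep (Fin 2) 1) (fundamentalRep (Fin 2) (y e)) / 2) * gegenbauerSum 1 1 (hsForm 2 (fundamentalRep (Fin 2) 1) (fundamentalRep (Fin 2) (y e)) / 2) = |gegenbauerSum 1 1 (hsForm 2 (fundamentalRep (Fin 2) 1) (fundamentalRep (Fin 2) (y e)) / 2)| ^ 2 := by rw [sq_abs, sq]
        rw [hsq]
        nlinarith [abs_nonneg (gegenbauerSum 1 1 (hsForm 2 (fundamentalRep (Fin 2) 1) (fundamentalRep (Fin 2) (y e)) / 2)), hXb e y]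
      rw [integral_const, smul_eq_mul, probReal_univ, one_mul] at h4
      exact h4
    · rw [if_neg hee, mul_zero]
      have h := integral_prod_linkTrace_pi_haar (L := L) ({e, e'} : Finset (Edge 3 L))
      simp only [Finset.prod_pair hee] at h
      rw [h, if_neg (Finset.insert_ne_empty e {e'})]
  have hexp : ∀ y : GaugeConfig 3 L (Matrix.specialUnitaryGroup (Fin 2) ℂ), ((((Fintype.card (Edge 3 L) : ℝ))⁻¹ * ∑ e, gegenbauerSum 1 1 (hsForm 2 (fundamentalRep (Fin 2) 1) (fundamentalRep (Fin 2) (y e)) / 2))) ^ 2 = (Fintype.card (Edge 3 L) : ℝ)⁻¹ ^ 2 * ∑ e, ∑ e', gegenbauerSum 1 1 (hsForm 2 (fundamentalRep (Fin 2) 1) (fundamentalRep (Fin 2) (y e)) / 2) * gegenbauerSum 1 1 (hsForm 2 (fundamentalRep (Fin 2) 1) (fundamentalRep (Fin 2) (y e')) / 2) := by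
    intro y
    rw [mul_pow, sq (∑ e, _), Finset.sum_mul_sum]
  simp_rw [hexp]
  rw [integral_const_mul, integral_finsetSum _ fun e _ => integrable_finsetSum _ fun e' _ => hXXi e e']
  simp_rw [integral_finsetSum _ fun e' _ => hXXi _ e']
  have hsum : ∑ e : Edge 3 L, ∑ e' : Edge 3 L, ∫ y, gegenbauerSum 1 1 (hsForm 2 (fundamentalRep (Fin 2) 1) (fundamentalRep (Fin 2) (y e)) / 2) * gegenbauerSum 1 1 (hsForm 2 (fundamentalRep (Fin 2) 1) (fundamentalRep (Fin 2) (y e')) / 2) ∂π ≤ ∑ e : Edge 3 L, ∑ e' : Edge 3 L, (4 * (if e = e' then 1 else 0) : ℝ) :=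
    Finset.sum_le_sum fun e _ => Finset.sum_le_sum fun e' _ => hpair e e'
  have hval : ∑ e : Edge 3 L, ∑ e' : Edge 3 L, (4 * (if e = e' then 1 else 0) : ℝ) = 4 * (Fintype.card (Edge 3 L) : ℝ) := by
    have h2 : ∀ e : Edge 3 L, ∑ e' : Edge 3 L, (4 * (if e = e' then 1 else 0) : ℝ) = 4 := by
      intro e
      rw [Finset.sum_eq_single e]
      · simp
      · intro e' _ hne; rw [if_neg (Ne.symm hne)]; ring
      · intro h; exact absurd (Finset.mem_univ e) h
    simp_rw [h2]
    rw [Finset.sum_const, Finset.card_univ, nsmul_eq_mul]; ring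
  rw [hval] at hsum
  calc (Fintype.card (Edge 3 L) : ℝ)⁻¹ ^ 2 * ∑ e : Edge 3 L, ∑ e' : Edge 3 L, ∫ y, gegenbauerSum 1 1 (hsForm 2 (fundamentalRep (Fin 2) 1) (fundamentalRep (Fin 2) (y e)) / 2) * gegenbauerSum 1 1 (hsForm 2 (fundamentalRep (Fin 2) 1) (fundamentalRep (Fin 2) (y e')) / 2) ∂π ≤ (Fintype.card (Edge 3 L) : ℝ)⁻¹ ^ 2 * (4 * (Fintype.card (Edge 3 L) : ℝ)) :=
        mul_le_mul_of_nonneg_left hsum (by positivity)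
    _ = 4 / (Fintype.card (Edge 3 L) : ℝ) := by field_simp

end Summit.QuantumFields.YangMills.Theorems.ColdStartUniversality
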